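import Mathlib.Analysis.Complex.Convex
import Mathlib.Analysis.SpecialFunctions.Complex.Log
import Mathlib.MeasureTheory.Measure.Lebesgue.Complex
import Mathlib.LinearAlgebra.Complex.FiniteDimensional
import HarnessLib

/-!
# Hedgehogs of radial spokes in `ℂ`: compact, thin, with connected complement

A HEDGEHOG is the origin together with radial spokes
`{χⱼ e^{-lh} : l ≥ cⱼ} = χⱼ · (0, e^{-cⱼ h}]` (`|χⱼ| = 1`, `h > 0`, `cⱼ ≥ 0`) indexed by `j : ι`,
of which only finitely many are longer than any given length (`{j | cⱼ ≤ C}` finite for every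
`C`). Such a set is a compact subset of the closed unit disc with connected complement, and when
`ι` is countable it is Lebesgue-null, hence has empty interior: exactly the hypotheses of
Lavrentiev's case `K° = ∅` of Mergelyan's theorem (`P(K) = C(K)`), which is how it is consumed in
`Literature/Analysis/Complex/HedgehogMoments.lean` (moments of measures living on the spokes).

* `hedgehog χ c h` — the set; `mem_hedgehog`, `zero_mem_hedgehog`, `mul_exp_mem_hedgehog`,
  `norm_le_one_of_mem_hedgehog`, `ofReal_mul_notMem_hedgehog` (spokes are star-shaped from `0`),
  `singleton_union_spoke_eq` (a spoke plus the origin is the segment `χⱼ · [0, e^{-cⱼ h}]`);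
* `isCompact_hedgehog` — closed (the finitely many long spokes are compact segments, the short
  ones lie in a small disc around the limit point `0`) and bounded;
* `volume_hedgehog_eq_zero`, `interior_hedgehog_eq_empty` — a hedgehog lies on countably many
  real lines through `0` (proper `ℝ`-subspaces of `ℂ` are null, `Measure.addHaar_submodule`);
* `isPreconnected_one_lt_norm` — the exterior `{|w| > 1} = exp {Re z > 0}` of the closed unit
  disc is connected; `isPreconnected_compl_hedgehog` — every point off the hedgehog escapes
  radially to that exterior.

All of this is elementary plane topology. [folklore]
-/

noncomputable section

namespace Literature.Analysis.Complex

open _root_.MeasureTheory Set Filter Metric _root_.Complex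
open scoped Real _root_.Topology

/-- The hedgehog of spokes `χⱼ · [0, e^{-cⱼ h}]` together with the origin. [folklore] -/
def hedgehog {ι : Type*} (χ : ι → ℂ) (c : ι → ℝ) (h : ℝ) : Set ℂ :=
  {0} ∪ ⋃ j, (fun l : ℝ => χ j * (Real.exp (-(l * h)) : ℂ)) '' Set.Ici (c j)

variable {ι : Type*} {χ : ι → ℂ} {c : ι → ℝ} {h : ℝ}

/-- Membership in a hedgehog. [folklore] -/
theorem mem_hedgehog {z : ℂ} : z ∈ hedgehog χ c h ↔
    z = 0 ∨ ∃ j l, c j ≤ l ∧ χ j * (Real.exp (-(l * h)) : ℂ) = z := by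
  simp [hedgehog]

/-- The origin lies in every hedgehog. [folklore] -/
theorem zero_mem_hedgehog : (0 : ℂ) ∈ hedgehog χ c h := mem_hedgehog.2 (Or.inl rfl)

/-- Points of the spokes lie in the hedgehog. [folklore] -/
theorem mul_exp_mem_hedgehog (j : ι) {l : ℝ} (hl : c j ≤ l) :
    χ j * (Real.exp (-(l * h)) : ℂ) ∈ hedgehog χ c h :=
  mem_hedgehog.2 (Or.inr ⟨j, l, hl, rfl⟩)

/-- The norm of a spoke point. [folklore] -/
theorem norm_unit_mul_ofReal_exp (hχ : ∀ j, ‖χ j‖ = 1) (j : ι) (u : ℝ) :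
    ‖χ j * (Real.exp u : ℂ)‖ = Real.exp u := by
  rw [norm_mul, hχ j, one_mul, Complex.norm_real, Real.norm_of_nonneg (Real.exp_pos u).le]

/-- A hedgehog lies in the closed unit disc. [folklore] -/
theorem norm_le_one_of_mem_hedgehog (hχ : ∀ j, ‖χ j‖ = 1) (hc : ∀ j, 0 ≤ c j) (hh : 0 ≤ h)
    {z : ℂ} (hz : z ∈ hedgehog χ c h) : ‖z‖ ≤ 1 := by
  rcases mem_hedgehog.1 hz with rfl | ⟨j, l, hl, rfl⟩
  · simp
  · rw [norm_unit_mul_ofReal_exp hχ, Real.exp_le_one_iff, neg_nonpos]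
    exact mul_nonneg ((hc j).trans hl) hh

/-- Spokes are star-shaped from the origin: scaling a point off the hedgehog by `s ≥ 1` keeps it
off the hedgehog. [folklore] -/
theorem ofReal_mul_notMem_hedgehog (hh : 0 < h) {z : ℂ} (hz : z ∉ hedgehog χ c h) {s : ℝ}
    (hs : 1 ≤ s) : (s : ℂ) * z ∉ hedgehog χ c h := by
  have hs0 : (0 : ℝ) < s := one_pos.trans_le hs
  intro hsz
  apply hz
  rcases mem_hedgehog.1 hsz with h0 | ⟨j, l, hl, hjl⟩
  · rw [mul_eq_zero, Complex.ofReal_eq_zero] at h0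
    exact h0.elim (fun h0 => (hs0.ne' h0).elim) fun h0 => h0 ▸ zero_mem_hedgehog
  · refine mem_hedgehog.2 (Or.inr ⟨j, l + Real.log s / h, ?_, ?_⟩)
    · exact hl.trans (le_add_of_nonneg_right (div_nonneg (Real.log_nonneg hs) hh.le))
    · have : Real.exp (-((l + Real.log s / h) * h)) = Real.exp (-(l * h)) / s := by
        rw [add_mul, div_mul_cancel₀ _ hh.ne', neg_add, Real.exp_add, Real.exp_neg (Real.log s),
          Real.exp_log hs0, div_eq_mul_inv]
      rw [this, Complex.ofReal_div, ← mul_div_assoc, hjl, mul_div_cancel_left₀]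
      exact Complex.ofReal_ne_zero.2 hs0.ne'

/-- A spoke together with the origin is a compact segment. [folklore] -/
theorem singleton_union_spoke_eq (hh : 0 < h) (j : ι) :
    ({0} ∪ (fun l : ℝ => χ j * (Real.exp (-(l * h)) : ℂ)) '' Ici (c j) : Set ℂ) =
      (fun t : ℝ => χ j * (t : ℂ)) '' Icc 0 (Real.exp (-(c j * h))) := by
  apply Subset.antisymm
  · rintro z (rfl | ⟨l, hl, rfl⟩)
    · exact ⟨0, ⟨le_rfl, (Real.exp_pos _).le⟩, by simp⟩
    · refine ⟨Real.exp (-(l * h)), ⟨(Real.exp_pos _).le, ?_⟩, rfl⟩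
      exact Real.exp_le_exp.2 (neg_le_neg (mul_le_mul_of_nonneg_right hl hh.le))
  · rintro z ⟨t, ⟨ht0, ht1⟩, rfl⟩
    rcases ht0.eq_or_lt with rfl | ht0
    · exact Or.inl (by simp)
    · refine Or.inr ⟨-Real.log t / h, ?_, ?_⟩
      · rw [mem_Ici, le_div_iff₀ hh, le_neg]
        exact (Real.log_le_iff_le_exp ht0).2 ht1
      · simp only
        rw [div_mul_cancel₀ _ hh.ne', neg_neg, Real.exp_log ht0]

/-- A hedgehog with finitely many spokes beyond every length is compact. [folklore] -/
theorem isCompact_hedgehog (hχ : ∀ j, ‖χ j‖ = 1) (hc : ∀ j, 0 ≤ c j)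
    (hfin : ∀ C : ℝ, {j : ι | c j ≤ C}.Finite) (hh : 0 < h) : IsCompact (hedgehog χ c h) := by
  refine Metric.isCompact_of_isClosed_isBounded (isClosed_of_closure_subset fun z hz => ?_)
    ((Metric.isBounded_closedBall (x := (0 : ℂ)) (r := 1)).subset fun z hz =>
      mem_closedBall_zero_iff.2 (norm_le_one_of_mem_hedgehog hχ hc hh.le hz))
  by_cases hz0 : z = 0
  · exact hz0 ▸ zero_mem_hedgehog
  have hzpos : 0 < ‖z‖ := norm_pos_iff.2 hz0
  -- a length scale below `‖z‖`
  set C : ℝ := -Real.log (‖z‖ / 2) / h with hC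
  have hCz : Real.exp (-(C * h)) < ‖z‖ := by
    rw [hC, div_mul_cancel₀ _ hh.ne', neg_neg, Real.exp_log (by positivity)]
    linarith
  -- the finitely many long spokes
  set A : Set ℂ :=
    ⋃ j ∈ {j : ι | c j ≤ C}, (fun t : ℝ => χ j * (t : ℂ)) '' Icc 0 (Real.exp (-(c j * h))) with hA
  have hAc : IsClosed A :=
    (hfin C).isClosed_biUnion fun j _ => ((isCompact_Icc.image (by fun_prop)).isClosed)
  have hAK : A ⊆ hedgehog χ c h := by
    intro w hw
    simp only [hA, mem_iUnion] at hw
    obtain ⟨j, -, hw⟩ := hw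
    rw [← singleton_union_spoke_eq hh j] at hw
    rcases hw with hw | ⟨l, hl, rfl⟩
    · exact hw ▸ zero_mem_hedgehog
    · exact mul_exp_mem_hedgehog j hl
  have hKA : hedgehog χ c h ⊆ A ∪ closedBall 0 (Real.exp (-(C * h))) := by
    intro w hw
    rcases mem_hedgehog.1 hw with rfl | ⟨j, l, hl, rfl⟩
    · exact Or.inr (mem_closedBall_zero_iff.2 (by simpa using (Real.exp_pos _).le))
    by_cases hj : c j ≤ C
    · refine Or.inl ?_
      simp only [hA, mem_iUnion]
      refine ⟨j, hj, ?_⟩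
      rw [← singleton_union_spoke_eq hh j]
      exact Or.inr ⟨l, hl, rfl⟩
    · refine Or.inr (mem_closedBall_zero_iff.2 ?_)
      rw [norm_unit_mul_ofReal_exp hχ]
      exact Real.exp_le_exp.2 (neg_le_neg (mul_le_mul_of_nonneg_right
        ((not_le.1 hj).le.trans hl) hh.le))
  rcases closure_minimal hKA (hAc.union isClosed_closedBall) hz with hzA | hzB
  · exact hAK hzA
  · exact absurd (mem_closedBall_zero_iff.1 hzB) hCz.not_ge

/-- A hedgehog is Lebesgue-null (it lies on countably many real lines). [folklore] -/
theorem volume_hedgehog_eq_zero [Countable ι] (hχ : ∀ j, ‖χ j‖ = 1) :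
    volume (hedgehog χ c h) = 0 := by
  refine measure_union_null (measure_singleton 0) (measure_iUnion_null fun j => ?_)
  refine measure_mono_null ?_
    (Measure.addHaar_submodule volume (Submodule.span ℝ {χ j}) ?_)
  · rintro _ ⟨l, -, rfl⟩
    exact Submodule.mem_span_singleton.2 ⟨Real.exp (-(l * h)), by rw [Complex.real_smul, mul_comm]⟩
  · intro htop
    have h1 := finrank_span_singleton (K := ℝ) (v := χ j)
      (by intro h0; simpa [h0] using hχ j)
    rw [htop, finrank_top, Complex.finrank_real_complex] at h1
    norm_num at h1

/-- A hedgehog (with countably many spokes) has empty interior. [folklore] -/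
theorem interior_hedgehog_eq_empty [Countable ι] (hχ : ∀ j, ‖χ j‖ = 1) :
    interior (hedgehog χ c h) = ∅ :=
  (isOpen_interior.measure_eq_zero_iff volume).1
    (measure_mono_null interior_subset (volume_hedgehog_eq_zero hχ))

/-- The exterior of the closed unit disc is preconnected (it is `exp` of a half-plane).
[folklore] -/
theorem isPreconnected_one_lt_norm : IsPreconnected {w : ℂ | 1 < ‖w‖} := by
  have : {w : ℂ | 1 < ‖w‖} = exp '' {z : ℂ | 0 < z.re} := by
    apply Subset.antisymm
    · intro w hw
      have hw0 : w ≠ 0 := norm_pos_iff.1 (one_pos.trans hw)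
      refine ⟨log w, ?_, exp_log hw0⟩
      have := norm_exp (log w)
      rw [exp_log hw0] at this
      simpa [this] using hw
    · rintro _ ⟨z, hz, rfl⟩
      simpa [norm_exp] using hz
  rw [this]
  exact (convex_halfSpace_re_gt 0).isPreconnected.image _ continuous_exp.continuousOn

/-- The complement of a hedgehog is connected (radial escape to `{‖z‖ > 1}`). [folklore] -/
theorem isPreconnected_compl_hedgehog (hχ : ∀ j, ‖χ j‖ = 1) (hc : ∀ j, 0 ≤ c j) (hh : 0 < h) :
    IsPreconnected (hedgehog χ c h)ᶜ := by
  have hO : {w : ℂ | 1 < ‖w‖} ⊆ (hedgehog χ c h)ᶜ := fun w hw hK =>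
    (norm_le_one_of_mem_hedgehog hχ hc hh.le hK).not_gt hw
  refine isPreconnected_of_forall (2 : ℂ) fun y hy => ?_
  have hy0 : y ≠ 0 := fun h0 => hy (h0 ▸ zero_mem_hedgehog)
  have hypos : 0 < ‖y‖ := norm_pos_iff.2 hy0
  refine ⟨(fun s : ℝ => (s : ℂ) * y) '' Ici 1 ∪ {w : ℂ | 1 < ‖w‖}, ?_, ?_, ?_, ?_⟩
  · rintro w (⟨s, hs, rfl⟩ | hw)
    exacts [ofReal_mul_notMem_hedgehog hh hy hs, hO hw]
  · exact Or.inr (by norm_num)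
  · exact Or.inl ⟨1, self_mem_Ici, by simp⟩
  · refine IsPreconnected.union (((‖y‖⁻¹ + 1 : ℝ) : ℂ) * y) ⟨‖y‖⁻¹ + 1, ?_, rfl⟩ ?_
      (isPreconnected_Ici.image _ (by fun_prop)) isPreconnected_one_lt_norm
    · exact le_add_of_nonneg_left (inv_nonneg.2 hypos.le)
    · show 1 < ‖((‖y‖⁻¹ + 1 : ℝ) : ℂ) * y‖
      rw [norm_mul, Complex.norm_real, Real.norm_of_nonneg (by positivity), add_mul,
        inv_mul_cancel₀ hypos.ne', one_mul]
      linarith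

end Literature.Analysis.Complex
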